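import Summits.QuantumFields.YangMills.Theorems.UnitScaleTiltProp7LandauTransversalityReduction
import HarnessLib

/-!
# Route `UnitScaleTilt`, crux K1 child «MinimiserStabilityRegPr» (stmt-QuantumFields-19200), skeleton v10, stub `stub_existenceMinimalOrbit` (EX), route (α) —
# **(P2-core) «LANDAU TRANSVERSALITY ON THE RESIDUAL GAUGE ALGEBRA» REDUCED TO ONE PAIRING: the hypothesis `hcore` of ✓`Prop7LandauTransversalityReduction.hSplitP2_of_core`
# holds as soon as, for every residual gauge parameter `l ∈ N_S(U₀)` with `Δ^η_{U₀} l ≠ 0`, SOME pushed gauge direction `w = M⁻¹·Gd N′` that is tangent to the twisted slice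
# (`T w = 0`) pairs non-trivially with `D_{U₀}Δ^η_{U₀} l` — the chart derivative `Dχ(A′)` DROPS OUT exactly (`Q(U₀)∘H = id`, `range (1 − Dχ(A′)) ⊆ range H`, and the knit's
# displayed Landau row `h45L : R_S(U₀)D*_{U₀}∘H = 0`)** (design: ★px10 g0 `pub/ym3-torus/ym3-torus-px10/R2-DESIGN-P2-CORE-px10.md` §1–§2 with ★w5-20520 g6
# `LOCATE-TRANSPORT-ONTO-w5g6.md` v4 §7; this file settles the design's open point (Q2′): the test vectors of the TRUE (P2-core) — print's slice is `ker Q ∩ ker R_S D*` with `R_S` the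
# orthogonal projection onto `Δ^η_{U₀}N_S` — are `D_{U₀}Δ^η_{U₀} l`, `l ∈ N_S`, and no energy-norm bound on `R_S` is needed).

Cell `ym3-torus`, width seat `ym-ust-20520-w5` (gen 7).  THEOREMS ONLY (0 `def`, 0 `sorry`).  `--supports stmt-QuantumFields-19200 --as helper`, count-neutral.  YM₃ on T³ is a
ladder rung (R3), not the Clay problem; nothing here claims the stub, the crux, d = 4 or the mass gap.

THE ROW.  After T5-B (P1) (✓`Prop7TwistedSliceGaugeOntoOfRegPr`), the θ-hand (✓`Prop7TwistedSliceGaugeOntoSU2OfRegPr`) and R1∕R1b (✓`Prop7LandauTransversalityReduction(SU2)`), the EX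
display's `hSplit`∕`hSplitD` rests on (P2-core) ALONE: «for every `l` with `toL2S l ∈ N_S(U₀)` the pushed `U₀`-gauge direction `M(Dχ(A′)(D_{U₀} l))` is `M(Dχ(A′)σ′) + Gd N′` with `σ′`
in print's linear slice (`Q(U₀)σ′ = 0`, `R_S(U₀)D*_{U₀}σ′ = 0`)».  Writing `v := M⁻¹Gd N′` and `v′ := Dχ(A′)⁻¹ v`, the slice conditions on `σ′ := D_{U₀}l − v′` read (i) `Q(U₀)v′ = 0`
⟺ `T v = 0` (`T := fderiv(log U̿^{twS})(χA′)`, `T ∘ Dχ(A′) = Q(U₀)`) and then `v′ = v − H(Q(U₀)v)` EXACTLY, so (ii) `R_S D*_{U₀} v′ = R_S D*_{U₀}D_{U₀} l = Δ^η_{U₀} l` ⟺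
`R_S D*_{U₀} v = Δ^η_{U₀} l` by `h45L`.  Hence (P2-core) ⟺ «`N′ ↦ R_S D*_{U₀}(M⁻¹Gd N′)` maps `𝒩′ := {N′ : T(M⁻¹Gd N′) = 0}` ONTO `Δ^η_{U₀}N_S = range R_S`», and in the
finite-dimensional Hilbert space `L²(T₀, 𝔤_ℂ)` onto-ness onto `range R_S` is the absence of a non-zero `R_S`-fixed vector orthogonal to the image — which, since `R_S` is symmetric
and fixes `Δ^η_{U₀}N_S` and `D*_{U₀}` is the adjoint of `D_{U₀}`, is the displayed PAIRING TEST.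

WHAT IS PROVED (sorry-free, no definition; ns `…Theorems.Prop7LandauTransversalityMargin`):
* §1 `mem_range_of_pairing` — abstract, any finite-dimensional complex inner-product space: if `P` fixes `range Λ` and `f₀`, and every non-zero `P`-fixed `f` has `⟪Λ v, f⟫ ≠ 0` for some
  `v`, then `f₀ ∈ range Λ` (orthogonal projection onto `range Λ`; [folklore]).
* §2 `eq_sub_H_of_QTwS_eq_zero` — the chart derivative drops out: `D v′ = v`, `v′ − D v′ ∈ range H`, `Q(U₀)∘H = id`, `Q(U₀)v′ = 0` ⟹ `v′ = v − H(Q(U₀)v)`.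
* §3 ★★★`hcore_of_pairing` — in the ABSTRACT setting of ✓`exists_slice_of_core` (`T ∘L D = Q(U₀)`, `D` onto) plus `Q(U₀)∘H = id`, `∀ v, ∃ y, v − D v = H y`, the knit's
  `h45L : ∀ Y, IsLandauPrintS U₀ (H Y)`, bondwise BIJECTIVE velocity maps `M b` and a LINEAR gauge-term map `Gd`: the PAIRING TEST
  «`∀ l, toL2S l ∈ N_S(U₀) → Δ^η_{U₀}(toL2S l) ≠ 0 → ∃ N′ w, (∀ b, M b (w b) = Gd N′ b) ∧ T w = 0 ∧ ⟪toL2 w, D_{U₀}(Δ^η_{U₀}(toL2S l))⟫ ≠ 0`» ⟹ the hypothesis `hcore` of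
  ✓`hSplitP2_of_core` VERBATIM.
* §4 ★★★`hSplitP2_of_pairing` — §3 ∘ ✓`hSplitP2_of_core` AT THE CHART, in the (D47) window (`range (1 − Dχ(A′)) ⊆ range H` derived there from `Dχ(A′) = 1 − H ∘ D(Dfix)(A′)`,
  lit ✓`B11Prop3Model.norm_fderiv_Dfix_le` at ✓`Prop7CmapTwSymInputs.inputs_CmapTwS`, as in ✓`norm_chartDeriv_sub_id_le`): (P2) at the chart point from the pairing test.
HONEST SCOPE.  Exact finite-dimensional bookkeeping over landed letters; the pairing test is a HYPOTHESIS — its supplier is the estimate «`⟪M⁻¹Gd(Jl), D_{U₀}Δ^η_{U₀} l⟫ ≥ (1 − θ)‖Δ^η_{U₀} l‖²`»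
for a transfer `J : N_S → 𝒩′` (LOCATE memo `pub/ym3-torus/ym-ust-20520-w5/g7/LOCATE-P2-MARGIN-w5g7.md`: covariant block Poincaré on `ker ns_k`, an `η`-free SECOND-ORDER smooth right
inverse of the frame-corrected operator `𝓚_{A₁}`, and the (19)-regularity of `χ(A′)` — NOT here); the `𝔰𝔲(2)` currency of `hSplitD` (✓`hSplitP2_su2_of_core`) is the θ-hand's twin;
nothing of print is asserted; no stub ∕ crux statement is advanced.

References: T. Bałaban, CMP 99 (1985) 389–434 [Balaban1985BackgroundPropagators] ((3.3) p.391, (3.8) p.392, (3.20)–(3.23) p.394, (3.110) p.417, (3.115) p.418, (3.124) p.420);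
CMP 102 (1985) 277–309 [Balaban1985Variational] ((44)–(49) p.285, (45) p.285, (63)–(73) pp.287–289, Prop. 3 p.289, (82)–(83) p.290); CMP 99 (1985) 75–102 [Balaban1985RegularSpaces]
(Sect. D pp.89–95).
-/

set_option autoImplicit false

noncomputable section

open scoped InnerProductSpace Matrix.Norms.L2Operator Topology
open Filter Metric

namespace Summit.QuantumFields.YangMills.Theorems.Prop7LandauTransversalityMargin

open Literature.MathematicalPhysics.QuantumFieldTheory.Balaban1983to89
open Literature.MathematicalPhysics.QuantumFieldTheory.Balaban1983to89.T3ContinuumYM3Torus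
open Literature.MathematicalPhysics.QuantumFieldTheory.Balaban1983to89.T3PrintedRegularMinimiser (RegPr)
open Literature.MathematicalPhysics.QuantumFieldTheory.Balaban1983to89.T3SectALandauChart (eta eta_pos)
open B11Prop3Model (Dfix norm_fderiv_Dfix_le)
open B11Eq103H1Complex (SiteL2K BondL2K)
open Summit.QuantumFields.YangMills.Theorems.Prop7SectET3Transport (periodsT3)
open Summit.QuantumFields.YangMills.Theorems.Prop7SymAvgTwSym (logChartTwS QTwS CmapTwS Chart47T3twS)
open Summit.QuantumFields.YangMills.Theorems.Prop7CmapTwSymInputs (inputs_CmapTwS)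
open Summit.QuantumFields.YangMills.Theorems.Prop7SectET3HilbertLetters (W₂ toL2 toL2S toL2B QL2 DL2 DstarL2 covLapSite QL2_toL2 adjoint_DL2)
open Summit.QuantumFields.YangMills.Theorems.Prop7SectET3GaugeProjector (NS RS RSPi DstarPi RSPi_apply DstarPi_apply QL2_DL2_eq_zero_of_mem_NS RS_isSymmetric
  RS_apply_covLapSite_of_mem RS_RS RS_apply_eq_self_iff)
open Summit.QuantumFields.YangMills.Theorems.Prop7SPrint (IsLandauPrintS)
open Summit.QuantumFields.YangMills.Theorems.Prop7LandauTransversalityReduction (fderiv_logChartTwS_comp_chartDeriv_eq_QTwS chartDeriv_surjective exists_slice_of_core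
  hSplitP2_of_core)

/-! ## §1 Finite-dimensional Hilbert-space lemma: onto-ness onto the `P`-fixed vectors from a pairing test -/

/-- **A `P`-FIXED VECTOR LIES IN `range Λ` AS SOON AS EVERY NON-ZERO `P`-FIXED VECTOR PAIRS NON-TRIVIALLY WITH `range Λ`** (when `P` fixes `range Λ`): the defect
`f₀ − proj_{range Λ} f₀` is `P`-fixed and orthogonal to `range Λ`, hence zero. [folklore] -/
theorem mem_range_of_pairing {E V : Type*} [NormedAddCommGroup E] [InnerProductSpace ℂ E] [FiniteDimensional ℂ E] [AddCommGroup V] [Module ℂ V]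
    (P : E →ₗ[ℂ] E) (Λ : V →ₗ[ℂ] E) (hΛ : ∀ v, P (Λ v) = Λ v)
    (htest : ∀ f : E, P f = f → f ≠ 0 → ∃ v, ⟪Λ v, f⟫_ℂ ≠ 0) (f₀ : E) (hf₀ : P f₀ = f₀) : f₀ ∈ LinearMap.range Λ := by
  haveI : CompleteSpace (LinearMap.range Λ) := FiniteDimensional.complete ℂ _
  have hfK : f₀ - (LinearMap.range Λ).starProjection f₀ ∈ (LinearMap.range Λ)ᗮ := (LinearMap.range Λ).sub_starProjection_mem_orthogonal f₀
  have hPproj : P ((LinearMap.range Λ).starProjection f₀) = (LinearMap.range Λ).starProjection f₀ := by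
    obtain ⟨v, hv⟩ := LinearMap.mem_range.1 ((LinearMap.range Λ).starProjection_apply_mem f₀)
    rw [← hv]; exact hΛ v
  have hPf : P (f₀ - (LinearMap.range Λ).starProjection f₀) = f₀ - (LinearMap.range Λ).starProjection f₀ := by rw [map_sub, hf₀, hPproj]
  by_cases hf0 : f₀ - (LinearMap.range Λ).starProjection f₀ = 0
  · exact (LinearMap.range Λ).starProjection_eq_self_iff.1 (sub_eq_zero.1 hf0).symm
  · obtain ⟨v, hv⟩ := htest _ hPf hf0
    exact absurd (Submodule.inner_right_of_mem_orthogonal (LinearMap.mem_range_self Λ v) hfK) hv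

/-! ## §2 The chart derivative drops out -/

variable (F : T3Family) {n K : ℕ} (h : n ≤ K)

/-- **`Dχ(A′)⁻¹ v = v − H(Q(U₀)v)` ON THE PREIMAGE OF THE TWISTED-SLICE TANGENTS**: if `D v′ = v`, `v′ − D v′ ∈ range H` (`Dχ(A′) = 1 − H∘D(Dfix)(A′)`), `Q(U₀)∘H = id` and `Q(U₀)v′ = 0`,
then `v′ = v − H(Q(U₀)v)`. [cite: Balaban1985Variational, (47)–(49) p.285, (70)–(71) p.289] -/
theorem eq_sub_H_of_QTwS_eq_zero (U₀ : GaugeField (F.P K) 0 (Matrix.specialUnitaryGroup (Fin 2) ℂ))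
    {H : (PBond (F.P n) 0 → Matrix (Fin 2) (Fin 2) ℂ) →ₗ[ℂ] (PBond (F.P K) 0 → Matrix (Fin 2) (Fin 2) ℂ)} (hQH : ∀ X, QTwS F n K h U₀ (H X) = X)
    {D : (PBond (F.P K) 0 → Matrix (Fin 2) (Fin 2) ℂ) →L[ℂ] (PBond (F.P K) 0 → Matrix (Fin 2) (Fin 2) ℂ)}
    (hDH : ∀ v : PBond (F.P K) 0 → Matrix (Fin 2) (Fin 2) ℂ, ∃ y, v - D v = H y)
    {v v' : PBond (F.P K) 0 → Matrix (Fin 2) (Fin 2) ℂ} (hv : D v' = v) (hQ : QTwS F n K h U₀ v' = 0) :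
    v' = v - H (QTwS F n K h U₀ v) := by
  obtain ⟨y, hy⟩ := hDH v'
  rw [hv] at hy
  have hv' : v' = v + H y := by rw [← hy, add_sub_cancel]
  have hy' : y = -QTwS F n K h U₀ v := by
    have h1 : QTwS F n K h U₀ v + y = 0 := by rw [← hQ, hv', map_add, hQH]
    exact eq_neg_of_add_eq_zero_right h1
  rw [hv', hy', map_neg, sub_eq_add_neg]

/-! ## §3 (P2-core) from the pairing test -/

/-- ★★★ **(P2-core) FROM THE PAIRING TEST.**  Setting of ✓`exists_slice_of_core` (`T ∘L D = Q(U₀)`, `D` onto), with `Q(U₀)∘H = id`, `range (1 − D) ⊆ range H`, the knit's Landau row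
`h45L : ∀ Y, IsLandauPrintS U₀ (H Y)`, bondwise bijective velocity maps `M b` and a linear gauge-term map `Gd`.  IF for every residual `l` (`toL2S l ∈ N_S(U₀)`) with `Δ^η_{U₀} l ≠ 0`
there are `N′` and `w` with `M w = Gd N′` bondwise, `T w = 0` and `⟪toL2 w, D_{U₀}Δ^η_{U₀} l⟫ ≠ 0, THEN (P2-core): every pushed residual gauge direction `M(D(D_{U₀} l))` is `M(Dσ′) + Gd N′`
with `Q(U₀)σ′ = 0`, `R_S(U₀)D*_{U₀}σ′ = 0`.  Proof: `𝒩′ := ker (T ∘ M⁻¹Gd)`, `Λ := R_S D*_{U₀} M⁻¹Gd|_{𝒩′}` has range inside `range R_S = Δ^η_{U₀}N_S` and §1 with the test puts `Δ^η_{U₀} l`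
in it; with `v := M⁻¹Gd N′`, `v′ := D⁻¹v = v − H(Q v)` (§2), `σ′ := D_{U₀}l − v′` is in the slice by (3.115), (3.21) and `h45L`.
[cite: Balaban1985BackgroundPropagators, (3.3) p.391, (3.8) p.392, (3.20)–(3.23) p.394, (3.110) p.417, (3.115) p.418; Balaban1985Variational, (45) p.285, (47)–(49) p.285, (82)–(83) p.290] -/
theorem hcore_of_pairing {c₀ cB : ℝ} [Fact (0 < c₀)] [Fact (0 < cB)] (U₀ : GaugeField (F.P K) 0 (Matrix.specialUnitaryGroup (Fin 2) ℂ))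
    {T : (PBond (F.P K) 0 → Matrix (Fin 2) (Fin 2) ℂ) →L[ℂ] (PBond (F.P n) 0 → Matrix (Fin 2) (Fin 2) ℂ)}
    {D : (PBond (F.P K) 0 → Matrix (Fin 2) (Fin 2) ℂ) →L[ℂ] (PBond (F.P K) 0 → Matrix (Fin 2) (Fin 2) ℂ)}
    (hTD : T.comp D = QTwS F n K h U₀) (hDsurj : Function.Surjective D)
    {H : (PBond (F.P n) 0 → Matrix (Fin 2) (Fin 2) ℂ) →ₗ[ℂ] (PBond (F.P K) 0 → Matrix (Fin 2) (Fin 2) ℂ)} (hQH : ∀ X, QTwS F n K h U₀ (H X) = X)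
    (hDH : ∀ v : PBond (F.P K) 0 → Matrix (Fin 2) (Fin 2) ℂ, ∃ y, v - D v = H y) (h45L : ∀ Y, IsLandauPrintS F n K h c₀ cB U₀ (H Y))
    (M : PBond (F.P K) 0 → (Matrix (Fin 2) (Fin 2) ℂ →L[ℂ] Matrix (Fin 2) (Fin 2) ℂ)) (hM : ∀ b, Function.Bijective (M b))
    (Gd : (Site (F.P K) 0 → Matrix (Fin 2) (Fin 2) ℂ) →ₗ[ℂ] (PBond (F.P K) 0 → Matrix (Fin 2) (Fin 2) ℂ))
    (htest : ∀ l : Site (F.P K) 0 → Matrix (Fin 2) (Fin 2) ℂ, toL2S F K c₀ l ∈ NS F n K h c₀ cB U₀ →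
      covLapSite F n K c₀ U₀ (toL2S F K c₀ l) ≠ 0 →
      ∃ (N' : Site (F.P K) 0 → Matrix (Fin 2) (Fin 2) ℂ) (w : PBond (F.P K) 0 → Matrix (Fin 2) (Fin 2) ℂ),
        (∀ b, M b (w b) = Gd N' b) ∧ T w = 0 ∧ ⟪toL2 F K c₀ w, DL2 F n K c₀ U₀ (covLapSite F n K c₀ U₀ (toL2S F K c₀ l))⟫_ℂ ≠ 0) :
    ∀ l : Site (F.P K) 0 → Matrix (Fin 2) (Fin 2) ℂ, toL2S F K c₀ l ∈ NS F n K h c₀ cB U₀ →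
      ∃ σ' : PBond (F.P K) 0 → Matrix (Fin 2) (Fin 2) ℂ, QTwS F n K h U₀ σ' = 0 ∧ IsLandauPrintS F n K h c₀ cB U₀ σ' ∧
        ∃ N' : Site (F.P K) 0 → Matrix (Fin 2) (Fin 2) ℂ,
          ∀ b, M b (D ((toL2 F K c₀).symm (DL2 F n K c₀ U₀ (toL2S F K c₀ l))) b) = M b (D σ' b) + Gd N' b := by
  intro l hl
  -- the bondwise inverse velocity maps and `X := M⁻¹Gd`
  let Me : PBond (F.P K) 0 → (Matrix (Fin 2) (Fin 2) ℂ ≃ₗ[ℂ] Matrix (Fin 2) (Fin 2) ℂ) := fun b =>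
    LinearEquiv.ofBijective ((M b : Matrix (Fin 2) (Fin 2) ℂ →L[ℂ] Matrix (Fin 2) (Fin 2) ℂ) : Matrix (Fin 2) (Fin 2) ℂ →ₗ[ℂ] Matrix (Fin 2) (Fin 2) ℂ) (hM b)
  have hMe : ∀ b x, Me b x = M b x := fun b x => rfl
  have hMsymm : ∀ b y, M b ((Me b).symm y) = y := fun b y => by rw [← hMe, LinearEquiv.apply_symm_apply]
  let X : (Site (F.P K) 0 → Matrix (Fin 2) (Fin 2) ℂ) →ₗ[ℂ] (PBond (F.P K) 0 → Matrix (Fin 2) (Fin 2) ℂ) :=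
    LinearMap.pi fun b => (Me b).symm.toLinearMap ∘ₗ LinearMap.proj b ∘ₗ Gd
  have hX : ∀ N' b, X N' b = (Me b).symm (Gd N' b) := fun N' b => rfl
  have hMX : ∀ N' b, M b (X N' b) = Gd N' b := fun N' b => by rw [hX, hMsymm]
  -- the residual algebra at the chart point and the map `Λ`
  let 𝒩 : Submodule ℂ (Site (F.P K) 0 → Matrix (Fin 2) (Fin 2) ℂ) := LinearMap.ker (T.toLinearMap ∘ₗ X)
  let Λ : 𝒩 →ₗ[ℂ] SiteL2K ℂ 3 (periodsT3 F K) c₀ W₂ :=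
    (RS F n K h c₀ cB U₀ ∘ₗ DstarL2 F n K c₀ U₀ ∘ₗ (toL2 F K c₀).toLinearMap ∘ₗ X) ∘ₗ 𝒩.subtype
  have hΛ : ∀ v : 𝒩, Λ v = RS F n K h c₀ cB U₀ (DstarL2 F n K c₀ U₀ (toL2 F K c₀ (X (v : Site (F.P K) 0 → Matrix (Fin 2) (Fin 2) ℂ)))) := fun v => rfl
  have hΛfix : ∀ v : 𝒩, RS F n K h c₀ cB U₀ (Λ v) = Λ v := fun v => by rw [hΛ, RS_RS]
  -- the abstract pairing test
  have htest' : ∀ f : SiteL2K ℂ 3 (periodsT3 F K) c₀ W₂, RS F n K h c₀ cB U₀ f = f → f ≠ 0 → ∃ v : 𝒩, ⟪Λ v, f⟫_ℂ ≠ 0 := by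
    intro f hf hf0
    obtain ⟨l₁, hl₁, rfl⟩ := (RS_apply_eq_self_iff U₀ f).1 hf
    have hl₁' : toL2S F K c₀ ((toL2S F K c₀).symm l₁) ∈ NS F n K h c₀ cB U₀ := by rwa [LinearEquiv.apply_symm_apply]
    have hf0' : covLapSite F n K c₀ U₀ (toL2S F K c₀ ((toL2S F K c₀).symm l₁)) ≠ 0 := by rwa [LinearEquiv.apply_symm_apply]
    obtain ⟨N', w, hMw, hTw, hpair⟩ := htest _ hl₁' hf0'
    rw [LinearEquiv.apply_symm_apply] at hpair
    have hwX : w = X N' := by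
      funext b
      rw [hX, LinearEquiv.eq_symm_apply, hMe]
      exact hMw b
    have hN' : N' ∈ 𝒩 := by
      rw [LinearMap.mem_ker, LinearMap.comp_apply, ContinuousLinearMap.coe_coe, ← hwX, hTw]
    refine ⟨⟨N', hN'⟩, ?_⟩
    rw [hΛ, Submodule.coe_mk, ← hwX, RS_isSymmetric U₀, RS_apply_covLapSite_of_mem U₀ hl₁, ← adjoint_DL2, LinearMap.adjoint_inner_left]
    exact hpair
  -- `Δ^η_{U₀} l` is hit
  have hmem : covLapSite F n K c₀ U₀ (toL2S F K c₀ l) ∈ LinearMap.range Λ :=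
    mem_range_of_pairing (RS F n K h c₀ cB U₀) Λ hΛfix htest' _ (RS_apply_covLapSite_of_mem U₀ hl)
  obtain ⟨v, hv⟩ := LinearMap.mem_range.1 hmem
  rw [hΛ] at hv
  set N' : Site (F.P K) 0 → Matrix (Fin 2) (Fin 2) ℂ := (v : Site (F.P K) 0 → Matrix (Fin 2) (Fin 2) ℂ) with hN'def
  have hTN' : T (X N') = 0 := by
    have := v.2
    rw [LinearMap.mem_ker, LinearMap.comp_apply, ContinuousLinearMap.coe_coe] at this
    exact this
  -- pull back through the chart derivative
  obtain ⟨v', hv'⟩ := hDsurj (X N')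
  have hQv' : QTwS F n K h U₀ v' = 0 := by
    have h1 := DFunLike.congr_fun hTD v'
    rw [ContinuousLinearMap.comp_apply, hv'] at h1
    rw [← h1, hTN']
  have hv'eq : v' = X N' - H (QTwS F n K h U₀ (X N')) := eq_sub_H_of_QTwS_eq_zero F h U₀ hQH hDH hv' hQv'
  -- the slice vector
  set g : PBond (F.P K) 0 → Matrix (Fin 2) (Fin 2) ℂ := (toL2 F K c₀).symm (DL2 F n K c₀ U₀ (toL2S F K c₀ l)) with hgdef
  have hQg : QTwS F n K h U₀ g = 0 := by
    have h1 : QL2 F n K h c₀ cB U₀ (toL2 F K c₀ g) = 0 := by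
      rw [hgdef, LinearEquiv.apply_symm_apply, QL2_DL2_eq_zero_of_mem_NS U₀ hl]
    rw [QL2_toL2] at h1
    exact (toL2B F n cB).injective (by rw [h1, map_zero])
  have h45L' : ∀ Y, RS F n K h c₀ cB U₀ (DstarL2 F n K c₀ U₀ (toL2 F K c₀ (H Y))) = 0 := by
    intro Y
    have h1 : RSPi F n K h c₀ cB U₀ (DstarPi F n K c₀ U₀ (H Y)) = 0 := h45L Y
    rw [RSPi_apply, DstarPi_apply, LinearEquiv.apply_symm_apply, LinearEquiv.map_eq_zero_iff] at h1
    exact h1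
  refine ⟨g - v', by rw [map_sub, hQg, hQv', sub_zero], ?_, N', fun b => ?_⟩
  · show RSPi F n K h c₀ cB U₀ (DstarPi F n K c₀ U₀ (g - v')) = 0
    rw [RSPi_apply, DstarPi_apply, LinearEquiv.apply_symm_apply, LinearEquiv.map_eq_zero_iff, hv'eq, map_sub, map_sub, hgdef,
      LinearEquiv.apply_symm_apply, map_sub, map_sub, map_sub, map_sub, h45L', sub_zero, hv]
    have hΔ : DstarL2 F n K c₀ U₀ (DL2 F n K c₀ U₀ (toL2S F K c₀ l)) = covLapSite F n K c₀ U₀ (toL2S F K c₀ l) := rfl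
    rw [hΔ, RS_apply_covLapSite_of_mem U₀ hl, sub_self]
  · rw [map_sub, Pi.sub_apply, map_sub, hv', hMX, sub_add_cancel]

/-! ## §4 At the chart: (P2) from the pairing test -/

/-- **`range (1 − Dχ(A′)) ⊆ range H`** in the (D47) window (`U₀ ∈ 𝔘_k(ε₀)`, `10⁹L²e ≤ 1`, `10¹²L³ε₀ ≤ 1`, `‖HY‖ ≤ b‖Y‖`, `9C₂ˢbε < 1`, `6ε ≤ e·η`, `2‖A′‖ < ε`): `Dχ(A′) = 1 − H ∘ D(Dfix)(A′)` by
uniqueness of the derivative (`Dfix` differentiable at `A′` by lit ✓`B11Prop3Model.norm_fderiv_Dfix_le` at ✓`inputs_CmapTwS`, exactly as in ✓`norm_chartDeriv_sub_id_le`), so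
`v − Dχ(A′)v = H(D(Dfix)(A′)v)`. [cite: Balaban1985Variational, (63)–(73) pp.287–289, Prop. 3 p.289] -/
theorem exists_sub_chartDeriv_eq_H [Fact (0 < (F.L : ℝ))] {ε₀ e b ε : ℝ} (hε₀ : 0 < ε₀) (he : 0 < e) (hWe : 10 ^ 9 * (F.L : ℝ) ^ 2 * e ≤ 1) (hWε : 10 ^ 12 * (F.L : ℝ) ^ 3 * ε₀ ≤ 1)
    (U₀ : GaugeField (F.P K) 0 (Matrix.specialUnitaryGroup (Fin 2) ℂ)) (hreg : RegPr F n K ε₀ U₀)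
    {H : (PBond (F.P n) 0 → Matrix (Fin 2) (Fin 2) ℂ) →ₗ[ℂ] (PBond (F.P K) 0 → Matrix (Fin 2) (Fin 2) ℂ)} (hb : 0 ≤ b) (hHop : ∀ Y, ‖H Y‖ ≤ b * ‖Y‖)
    (hq : 9 * (40 * (2 * (3 * (2 * e + 2700 * (F.L : ℝ) * ε₀))) / (e * eta F n K) ^ 2) * b * ε < 1) (hRε : 6 * ε ≤ e * eta F n K)
    {A' : PBond (F.P K) 0 → Matrix (Fin 2) (Fin 2) ℂ} (hA' : 2 * ‖A'‖ < ε)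
    {D : (PBond (F.P K) 0 → Matrix (Fin 2) (Fin 2) ℂ) →L[ℂ] (PBond (F.P K) 0 → Matrix (Fin 2) (Fin 2) ℂ)}
    (hD : HasFDerivAt (fun A : PBond (F.P K) 0 → Matrix (Fin 2) (Fin 2) ℂ =>
      A - H (Dfix (CmapTwS F n K h U₀) H (40 * (2 * (3 * (2 * e + 2700 * (F.L : ℝ) * ε₀))) / (e * eta F n K) ^ 2) A)) D A') :
    ∀ v : PBond (F.P K) 0 → Matrix (Fin 2) (Fin 2) ℂ, ∃ y, v - D v = H y := by
  haveI : CompleteSpace (PBond (F.P n) 0 → Matrix (Fin 2) (Fin 2) ℂ) := FiniteDimensional.complete ℂ _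
  haveI : CompleteSpace (PBond (F.P K) 0 → Matrix (Fin 2) (Fin 2) ℂ) := FiniteDimensional.complete ℂ _
  set C₂ : ℝ := 40 * (2 * (3 * (2 * e + 2700 * (F.L : ℝ) * ε₀))) / (e * eta F n K) ^ 2 with hC₂def
  have hη : 0 < eta F n K := eta_pos F n K
  have hC₂ : 0 ≤ C₂ := by
    have hL : (0 : ℝ) < (F.L : ℝ) := Fact.out
    positivity
  -- `H` as a continuous linear map, with operator norm `≤ b`
  set Hc : (PBond (F.P n) 0 → Matrix (Fin 2) (Fin 2) ℂ) →L[ℂ] (PBond (F.P K) 0 → Matrix (Fin 2) (Fin 2) ℂ) := LinearMap.toContinuousLinearMap H with hHc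
  have hHcH : (Hc : (PBond (F.P n) 0 → Matrix (Fin 2) (Fin 2) ℂ) →ₗ[ℂ] (PBond (F.P K) 0 → Matrix (Fin 2) (Fin 2) ℂ)) = H := LinearMap.coe_toContinuousLinearMap H
  have hin : B11Prop3Model.Inputs (CmapTwS F n K h U₀) (Hc : (PBond (F.P n) 0 → Matrix (Fin 2) (Fin 2) ℂ) →ₗ[ℂ] (PBond (F.P K) 0 → Matrix (Fin 2) (Fin 2) ℂ))
      C₂ C₂ b ((e * eta F n K) / 4) := by
    rw [hHcH]; exact inputs_CmapTwS F h hε₀ he hWe hWε U₀ hreg hHop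
  have hε₃ : 0 < ε / 2 := by linarith [norm_nonneg A']
  have h18 : 18 * C₂ * b * (ε / 2) ≤ 1 := by
    have : 18 * C₂ * b * (ε / 2) = 9 * C₂ * b * ε := by ring
    rw [this]; exact hq.le
  have h2 : 2 * (ε / 2) ≤ (e * eta F n K) / 4 := by linarith
  have hA'3 : ‖A'‖ < ε / 2 := by linarith
  obtain ⟨hDf, -⟩ := norm_fderiv_Dfix_le hin hC₂ hC₂ hb hε₃ h18 h2 hA'3
  rw [hHcH] at hDf
  -- `χ = id − H ∘ Dfix`, so `Dχ(A′) = 1 − Hc ∘ D(Dfix)(A′)` by uniqueness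
  have hχ : HasFDerivAt (fun A : PBond (F.P K) 0 → Matrix (Fin 2) (Fin 2) ℂ => A - H (Dfix (CmapTwS F n K h U₀) H C₂ A))
      ((1 : (PBond (F.P K) 0 → Matrix (Fin 2) (Fin 2) ℂ) →L[ℂ] (PBond (F.P K) 0 → Matrix (Fin 2) (Fin 2) ℂ))
        - Hc.comp (fderiv ℂ (Dfix (CmapTwS F n K h U₀) H C₂) A')) A' := by
    have h1 : HasFDerivAt (fun A : PBond (F.P K) 0 → Matrix (Fin 2) (Fin 2) ℂ => Hc (Dfix (CmapTwS F n K h U₀) H C₂ A))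
        (Hc.comp (fderiv ℂ (Dfix (CmapTwS F n K h U₀) H C₂) A')) A' := Hc.hasFDerivAt.comp A' hDf
    have h3 := (hasFDerivAt_id (𝕜 := ℂ) A').sub h1
    have hfun : (fun A : PBond (F.P K) 0 → Matrix (Fin 2) (Fin 2) ℂ => A - H (Dfix (CmapTwS F n K h U₀) H C₂ A))
        = fun A => id A - Hc (Dfix (CmapTwS F n K h U₀) H C₂ A) := by
      funext A; rw [id, LinearMap.coe_toContinuousLinearMap']
    rw [hfun]
    exact h3
  have hDeq : D = 1 - Hc.comp (fderiv ℂ (Dfix (CmapTwS F n K h U₀) H C₂) A') := hD.unique hχ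
  intro v
  refine ⟨fderiv ℂ (Dfix (CmapTwS F n K h U₀) H C₂) A' v, ?_⟩
  rw [hDeq, sub_apply, one_apply_eq_self, ContinuousLinearMap.comp_apply, sub_sub_cancel, hHc,
    LinearMap.coe_toContinuousLinearMap']

/-- ★★★ **(P2) «LANDAU TRANSVERSALITY AT THE CHART POINT» FROM THE PAIRING TEST** (= §3 ∘ ✓`hSplitP2_of_core`).  In the (D47) window of ✓`hSplitP2_of_core` (`U₀ ∈ 𝔘_k(ε₀)`,
`10⁹L²e ≤ 1`, `10¹²L³ε₀ ≤ 1`, `‖HY‖ ≤ b‖Y‖`, `9C₂ˢbε < 1`, `6ε ≤ e·η`, `2‖A′‖ < ε`, `Chart47T3twS C₂ˢ ε U₀ H`, `Q(U₀)∘H = id`, `HasFDerivAt χ D A′`), with the knit's Landau row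
`h45L : ∀ Y, IsLandauPrintS U₀ (H Y)`, bondwise bijective velocity maps `M b` (consumer: `gSer ℂ (ad ℂ (−χ(A′) b))`) and a linear gauge-term map `Gd` (consumer: `N ↦ (b ↦ N(b₋) − U′(b)N(b₊)U′(b)⁻¹)`):
IF the pairing test holds for `T := fderiv ℂ (logChartTwS U₀) (χ A′)`, THEN every `β` tangent to the twisted slice at `χ(A′)` is `Mβ = M(Dδ) + Gd N` with `Q(U₀)δ = 0`, `IsLandauPrintS U₀ δ`.
[cite: Balaban1985Variational, (44)–(49) p.285, (45) p.285, (82)–(83) p.290, Prop. 3 p.289; Balaban1985BackgroundPropagators, (3.20)–(3.23) p.394, (3.115) p.418; Balaban1985RegularSpaces, Sect. D pp.89–95] -/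
theorem hSplitP2_of_pairing [Fact (0 < (F.L : ℝ))] {c₀ cB : ℝ} [Fact (0 < c₀)] [Fact (0 < cB)]
    {ε₀ e b ε : ℝ} (hε₀ : 0 < ε₀) (he : 0 < e) (hWe : 10 ^ 9 * (F.L : ℝ) ^ 2 * e ≤ 1) (hWε : 10 ^ 12 * (F.L : ℝ) ^ 3 * ε₀ ≤ 1)
    (U₀ : GaugeField (F.P K) 0 (Matrix.specialUnitaryGroup (Fin 2) ℂ)) (hreg : RegPr F n K ε₀ U₀)
    {H : (PBond (F.P n) 0 → Matrix (Fin 2) (Fin 2) ℂ) →ₗ[ℂ] (PBond (F.P K) 0 → Matrix (Fin 2) (Fin 2) ℂ)} (hb : 0 ≤ b) (hHop : ∀ Y, ‖H Y‖ ≤ b * ‖Y‖)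
    (hq : 9 * (40 * (2 * (3 * (2 * e + 2700 * (F.L : ℝ) * ε₀))) / (e * eta F n K) ^ 2) * b * ε < 1) (hRε : 6 * ε ≤ e * eta F n K)
    (h47 : Chart47T3twS F n K h (40 * (2 * (3 * (2 * e + 2700 * (F.L : ℝ) * ε₀))) / (e * eta F n K) ^ 2) ε U₀ H) (hQH : ∀ X, QTwS F n K h U₀ (H X) = X)
    (h45L : ∀ Y, IsLandauPrintS F n K h c₀ cB U₀ (H Y))
    {A' : PBond (F.P K) 0 → Matrix (Fin 2) (Fin 2) ℂ} (hA' : 2 * ‖A'‖ < ε)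
    {D : (PBond (F.P K) 0 → Matrix (Fin 2) (Fin 2) ℂ) →L[ℂ] (PBond (F.P K) 0 → Matrix (Fin 2) (Fin 2) ℂ)}
    (hD : HasFDerivAt (fun A : PBond (F.P K) 0 → Matrix (Fin 2) (Fin 2) ℂ =>
      A - H (Dfix (CmapTwS F n K h U₀) H (40 * (2 * (3 * (2 * e + 2700 * (F.L : ℝ) * ε₀))) / (e * eta F n K) ^ 2) A)) D A')
    (M : PBond (F.P K) 0 → (Matrix (Fin 2) (Fin 2) ℂ →L[ℂ] Matrix (Fin 2) (Fin 2) ℂ)) (hM : ∀ b, Function.Bijective (M b))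
    (Gd : (Site (F.P K) 0 → Matrix (Fin 2) (Fin 2) ℂ) →ₗ[ℂ] (PBond (F.P K) 0 → Matrix (Fin 2) (Fin 2) ℂ))
    (htest : ∀ l : Site (F.P K) 0 → Matrix (Fin 2) (Fin 2) ℂ, toL2S F K c₀ l ∈ NS F n K h c₀ cB U₀ →
      covLapSite F n K c₀ U₀ (toL2S F K c₀ l) ≠ 0 →
      ∃ (N' : Site (F.P K) 0 → Matrix (Fin 2) (Fin 2) ℂ) (w : PBond (F.P K) 0 → Matrix (Fin 2) (Fin 2) ℂ),
        (∀ b, M b (w b) = Gd N' b) ∧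
        fderiv ℂ (logChartTwS F n K h U₀)
          (A' - H (Dfix (CmapTwS F n K h U₀) H (40 * (2 * (3 * (2 * e + 2700 * (F.L : ℝ) * ε₀))) / (e * eta F n K) ^ 2) A')) w = 0 ∧
        ⟪toL2 F K c₀ w, DL2 F n K c₀ U₀ (covLapSite F n K c₀ U₀ (toL2S F K c₀ l))⟫_ℂ ≠ 0)
    (β : PBond (F.P K) 0 → Matrix (Fin 2) (Fin 2) ℂ)
    (hβ : fderiv ℂ (logChartTwS F n K h U₀)
      (A' - H (Dfix (CmapTwS F n K h U₀) H (40 * (2 * (3 * (2 * e + 2700 * (F.L : ℝ) * ε₀))) / (e * eta F n K) ^ 2) A')) β = 0) :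
    ∃ δ : PBond (F.P K) 0 → Matrix (Fin 2) (Fin 2) ℂ, QTwS F n K h U₀ δ = 0 ∧ IsLandauPrintS F n K h c₀ cB U₀ δ ∧
      ∃ N : Site (F.P K) 0 → Matrix (Fin 2) (Fin 2) ℂ, ∀ b, M b (β b) = M b (D δ b) + Gd N b := by
  have hA'1 : ‖A'‖ < ε := by linarith [norm_nonneg A']
  exact hSplitP2_of_core F h hε₀ he hWe hWε U₀ hreg hb hHop hq hRε h47 hQH hA' hD M Gd
    (hcore_of_pairing F h U₀ (fderiv_logChartTwS_comp_chartDeriv_eq_QTwS F h hε₀ he hWe hWε U₀ hreg h47 hQH hRε hA'1 hD)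
      (chartDeriv_surjective F h hε₀ he hWe hWε U₀ hreg hb hHop hq hRε hA' hD) hQH
      (exists_sub_chartDeriv_eq_H F h hε₀ he hWe hWε U₀ hreg hb hHop hq hRε hA' hD) h45L M hM Gd htest) β hβ

end Summit.QuantumFields.YangMills.Theorems.Prop7LandauTransversalityMargin


end
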